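import Summits.ValiantsHypothesis.ValiantsHypothesis.Theorems.LacunarySymmetroidMatrixDescartesGraftToolkit
import Literature.LinearAlgebra.Matrix.GeneralizedVandermonde

/-!
# `MatrixDescartes` census — BORDERING LAW toolkit: a `K`-nomial with prescribed simple roots and its signs; bordered letters

HONEST FRAMING.  Object-search cell `pub-symmetroid`, crux `Theses.LacunarySymmetroid.MatrixDescartes`
(stmt-ValiantsHypothesis-18050); seat val-sym-mdr-p1 (g3).  A pure lemma file (no definitions, no claim about the crux or about
`VP ≠ VNP`) serving the BORDERING LAW (companion `…GraftBorderLaw.lean`: on a strictly increasing support one more ROW/COLUMN buys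
`#letters − 1` more alternations).  Contents:
* `genVandermonde_cons_sign` — for strictly increasing positive nodes `r_0 < ⋯ < r_{K−1}`, a strictly increasing support `d` of size `K+1`
  and a positive `y` in the gap number `c` of the nodes (`r_i < y` for `i < c`, `y < r_i` for `i ≥ c`), the generalised Vandermonde
  determinant with node vector `(y, r_0, …, r_{K−1})` has the sign `(−1)^c`.  Source of positivity: Literature
  `GeneralizedVandermonde.det_genVandermonde_pos` (Fischler–Sprang–Zudilin 2019, Lemma 4) after sorting the nodes by the cycle
  `Fin.cycleRange c` (sign `(−1)^c`, Mathlib `Fin.sign_cycleRange`, `Matrix.det_permute'`).  As a function of `y` this determinant is the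
  `K+1`-nomial `∑ l, y^(d l) · c_l` (`det_genVandermonde_cons`, Laplace along the first column) — a fewnomial ON THE GIVEN SUPPORT with the
  `K` prescribed simple roots `r_i` and known signs between them.
* bordered letters `reindex finSumFinEquiv (fromBlocks (S l) 0 0 (c_l • 1))` of size `m + 1`: evaluation (`border_eval`), determinant
  (`det_border_eval` = `det F(y) · ∑ l, y^(d l) c_l`) and symmetry (`isSymm_border`).
[folklore] throughout.
-/

-- `Summit.ValiantsHypothesis.ValiantsHypothesis.…` repeats a component by the D-0017 layout
-- (single-conjunct summit), which the `dupNamespace` linter flags; the name is mandated.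
set_option linter.dupNamespace false

namespace Summit.ValiantsHypothesis.ValiantsHypothesis.Theorems.LacunarySymmetroidMatrixDescartes.Census.Graft

open Matrix Finset Filter Topology
open scoped BigOperators
open Literature.LinearAlgebra.Matrix.GeneralizedVandermonde (genVandermonde genVandermonde_apply det_genVandermonde_pos)

/-! ### The fewnomial with prescribed roots: a generalised Vandermonde determinant in its first node -/

/-- **Sign of the generalised Vandermonde determinant with one unsorted node.**  Nodes `(y, r_0, …, r_{K−1})` with `r` strictly increasing
and positive, `y > 0` in gap `c` (`r_i < y ⇔ i < c`), exponents strictly increasing: the determinant has sign `(−1)^c`. [folklore] -/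
theorem genVandermonde_cons_sign {K : ℕ} (r : Fin K → ℝ) (hr : StrictMono r) (hr0 : ∀ i, 0 < r i)
    (d : Fin (K + 1) → ℕ) (hd : StrictMono d) (y : ℝ) (hy : 0 < y) (c : ℕ) (hc : c ≤ K)
    (hlo : ∀ i : Fin K, (i : ℕ) < c → r i < y) (hhi : ∀ i : Fin K, c ≤ (i : ℕ) → y < r i) :
    0 < (-1 : ℝ) ^ c * (genVandermonde (Fin.cons y r : Fin (K + 1) → ℝ) d).det := by
  classical
  set v : Fin (K + 1) → ℝ := Fin.cons y r with hv
  set cF : Fin (K + 1) := ⟨c, Nat.lt_succ_of_le hc⟩ with hcF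
  set σ : Equiv.Perm (Fin (K + 1)) := Fin.cycleRange cF with hσ
  -- the sorted node vector
  set w : Fin (K + 1) → ℝ := fun p =>
    if h : (p : ℕ) < c then r ⟨p, lt_of_lt_of_le h hc⟩
    else if h' : (p : ℕ) = c then y else r ⟨(p : ℕ) - 1, by omega⟩ with hw
  have hvσ : ∀ p, v (σ p) = w p := by
    intro p
    by_cases h1 : (p : ℕ) < c
    · have hlt : p < cF := Fin.lt_def.mpr h1
      have hval : ((σ p : Fin (K + 1)) : ℕ) = p + 1 := Fin.coe_cycleRange_of_lt hlt
      have hsp : σ p = Fin.succ ⟨p, lt_of_lt_of_le h1 hc⟩ := Fin.ext (by rw [hval]; simp)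
      rw [hsp]
      simp only [hv, Fin.cons_succ, hw, dif_pos h1]
    · by_cases h2 : (p : ℕ) = c
      · have hsp : σ p = 0 := Fin.cycleRange_of_eq (Fin.ext h2)
        rw [hsp]
        have h0 : v 0 = y := by simp only [hv, Fin.cons_zero]
        rw [h0]
        simp only [hw, dif_neg h1, dif_pos h2]
      · have hgt : cF < p := Fin.lt_def.mpr (by simp only [hcF]; omega)
        have hsp : σ p = p := Fin.cycleRange_of_gt hgt
        rw [hsp]
        have hp0 : p ≠ 0 := fun h => by rw [h] at hgt; exact absurd hgt (Fin.not_lt_zero cF)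
        have e : p = Fin.succ (p.pred hp0) := (Fin.succ_pred p hp0).symm
        have hvp : v p = r (p.pred hp0) := by
          conv_lhs => rw [e]
          simp only [hv, Fin.cons_succ]
        rw [hvp]
        simp only [hw, dif_neg h1, dif_neg h2]
        congr 1
  have hwmono : StrictMono w := by
    refine Fin.strictMono_iff_lt_succ.mpr fun p => ?_
    have hc' : ((Fin.castSucc p : Fin (K + 1)) : ℕ) = p := rfl
    have hs' : ((Fin.succ p : Fin (K + 1)) : ℕ) = p + 1 := rfl
    simp only [hw, hc', hs']
    by_cases h1 : (p : ℕ) + 1 < c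
    · rw [dif_pos (by omega : (p : ℕ) < c), dif_pos h1]
      exact hr (Fin.mk_lt_mk.mpr (by omega))
    · by_cases h2 : (p : ℕ) + 1 = c
      · rw [dif_pos (by omega : (p : ℕ) < c), dif_neg h1, dif_pos h2]
        have := hlo p (by omega)
        simpa using this
      · by_cases h3 : (p : ℕ) = c
        · rw [dif_neg (by omega : ¬ (p : ℕ) < c), dif_pos h3, dif_neg h1, dif_neg h2]
          have := hhi p (by omega)
          have e : (⟨(p : ℕ) + 1 - 1, by omega⟩ : Fin K) = p := Fin.ext (by simp)
          rw [e]; exact this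
        · rw [dif_neg (by omega : ¬ (p : ℕ) < c), dif_neg h3, dif_neg h1, dif_neg h2]
          exact hr (Fin.mk_lt_mk.mpr (by omega))
  have hwpos : ∀ p, 0 < w p := by
    intro p
    simp only [hw]
    split_ifs
    · exact hr0 _
    · exact hy
    · exact hr0 _
  have hposdet := det_genVandermonde_pos (K + 1) w d hwmono hwpos hd
  have hmat : genVandermonde w d = (genVandermonde v d).submatrix id σ := by
    ext i j
    simp only [genVandermonde_apply, Matrix.submatrix_apply, id, hvσ]
  have hsgn : (((Equiv.Perm.sign σ : ℤˣ) : ℤ) : ℝ) = (-1 : ℝ) ^ c := by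
    rw [hσ, Fin.sign_cycleRange]
    simp [hcF, Units.val_pow_eq_pow_val]
  rw [hmat, Matrix.det_permute', hsgn] at hposdet
  exact hposdet

/-- **Laplace along the first node**: the generalised Vandermonde determinant with node vector `(y, r)` is the fewnomial
`∑ l, y^(d l) · ((−1)^l · det [r_j^(d_i)]_{i ≠ l})` on the support `d`. [folklore] -/
theorem det_genVandermonde_cons {K : ℕ} (r : Fin K → ℝ) (d : Fin (K + 1) → ℕ) (y : ℝ) :
    (genVandermonde (Fin.cons y r : Fin (K + 1) → ℝ) d).det
      = ∑ i : Fin (K + 1), y ^ d i * ((-1) ^ (i : ℕ) * (genVandermonde r (d ∘ i.succAbove)).det) := by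
  rw [Matrix.det_succ_column_zero]
  refine Finset.sum_congr rfl fun i _ => ?_
  have hminor : (genVandermonde (Fin.cons y r : Fin (K + 1) → ℝ) d).submatrix i.succAbove Fin.succ
      = genVandermonde r (d ∘ i.succAbove) := by
    ext a b
    simp only [Matrix.submatrix_apply, genVandermonde_apply, Fin.cons_succ, Function.comp_apply]
  rw [hminor]
  simp only [genVandermonde_apply, Fin.cons_zero]
  ring

/-! ### Bordered letters -/

/-- Evaluation of the bordered pencil: block-diagonal of the old value and the `1 × 1` fewnomial value. [folklore] -/
theorem border_eval {m K : ℕ} (w : Fin K → ℝ) (S : Fin K → Matrix (Fin m) (Fin m) ℝ) (c : Fin K → ℝ) :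
    ∑ l, w l • (Matrix.reindex finSumFinEquiv finSumFinEquiv
        (Matrix.fromBlocks (S l) 0 0 (c l • (1 : Matrix (Fin 1) (Fin 1) ℝ))) : Matrix (Fin (m + 1)) (Fin (m + 1)) ℝ)
      = Matrix.reindex finSumFinEquiv finSumFinEquiv
          (Matrix.fromBlocks (∑ l, w l • S l) 0 0 ((∑ l, w l * c l) • (1 : Matrix (Fin 1) (Fin 1) ℝ))) := by
  ext i j
  simp only [Matrix.sum_apply, Matrix.smul_apply, Matrix.reindex_apply, Matrix.submatrix_apply, smul_eq_mul]
  rcases hi : finSumFinEquiv.symm i with i' | i' <;> rcases hj : finSumFinEquiv.symm j with j' | j' <;>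
    simp [Matrix.sum_apply, Finset.sum_mul, mul_assoc]

/-- Determinant of the bordered pencil value: `det F(y) · φ(y)`. [folklore] -/
theorem det_border_eval {m K : ℕ} (w : Fin K → ℝ) (S : Fin K → Matrix (Fin m) (Fin m) ℝ) (c : Fin K → ℝ) :
    (∑ l, w l • (Matrix.reindex finSumFinEquiv finSumFinEquiv
        (Matrix.fromBlocks (S l) 0 0 (c l • (1 : Matrix (Fin 1) (Fin 1) ℝ))) : Matrix (Fin (m + 1)) (Fin (m + 1)) ℝ)).det
      = (∑ l, w l • S l).det * ∑ l, w l * c l := by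
  rw [border_eval, Matrix.det_reindex_self, Matrix.det_fromBlocks_zero₂₁, Matrix.det_smul, Matrix.det_one,
    Fintype.card_fin, pow_one, mul_one]

/-- Bordered letters are symmetric when the old ones are. [folklore] -/
theorem isSymm_border {m : ℕ} (A : Matrix (Fin m) (Fin m) ℝ) (hA : A.IsSymm) (c : ℝ) :
    (Matrix.reindex finSumFinEquiv finSumFinEquiv
        (Matrix.fromBlocks A 0 0 (c • (1 : Matrix (Fin 1) (Fin 1) ℝ))) : Matrix (Fin (m + 1)) (Fin (m + 1)) ℝ).IsSymm := by
  unfold Matrix.IsSymm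
  rw [Matrix.transpose_reindex, Matrix.fromBlocks_transpose, Matrix.transpose_zero, Matrix.transpose_zero, hA.eq,
    Matrix.transpose_smul, Matrix.transpose_one]

end Summit.ValiantsHypothesis.ValiantsHypothesis.Theorems.LacunarySymmetroidMatrixDescartes.Census.Graft
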